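import Mathlib
import Summits.NavierStokesRegularity.NavierStokesRegularity.Theorems.TypeILiouvilleTypeIliouvilleLStubOseenConstBoost
import Summits.NavierStokesRegularity.NavierStokesRegularity.Theorems.TypeILiouvilleAxisTestDoor
import Summits.NavierStokesRegularity.NavierStokesRegularity.Theorems.DssFarFieldSlavingBlowupTypeIDssProfileSimilarityEnstrophyTimeOnlyThreshold
import Literature.Analysis.FluidPDE.TypeIAncientMild
import Literature.Analysis.FluidPDE.KNSSLocalSmoothingHolds
import Literature.Analysis.FluidPDE.OseenMildUniqueness
import Literature.Analysis.FluidPDE.NSBoundedMildOseenClassical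
import Literature.Analysis.FluidPDE.GigaMiura2011ScaledAlignmentBlowupLimitHolds
import Summits.NavierStokesRegularity.NavierStokesRegularity.Theses.SymmetryModuliCount
import Summits.NavierStokesRegularity.NavierStokesRegularity.Theses.ExtremalTypeIConstant
import HarnessLib

/-!
# TypeILiouvilleSelfSimilarFloorRate — decomp-ns ROOT CELL, lens 2, generation 22 — PART 1/4 (§1 THE FLOOR, §2 THE DOOR)

Split of the lens file `TypeILiouvilleSelfSimilarFloor.lean` (node «THE SELF-SIMILAR FLOOR», g22; description in
the module docstring of Part 4 = `Theorems.TypeILiouvilleSelfSimilarFloor`) at its section boundaries for the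
400-line Theorems rule; declaration bodies verbatim; the namespace `…Theorems.TypeILiouvilleSelfSimilarFloor`
is shared by the four parts so every declaration keeps its name. THIS PART = the THEOREM SIDE of the dial
«backward fading rate towards a stream, against the self-similar clock 1/√(−t)», in print's class P
(continuous on `t<0`, bounded, weakly div-free slices, mild heat/Oseen–Duhamel identity):
* §1 THE FLOOR (PROVED): `forward_bound` / `forward_bound_stream` (KNSS 2009 Prop. 4.1 local smoothing
  `knss2009_local_smoothing_holds` + uniqueness of bounded mild solutions `oseenMild_bounded_unique` + Galilean
  boost `stub_oseen_const_boost`), `const_of_backward_small_rate` — no bounded ancient mild solution approaches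
  a constant stream faster than self-similar, even along one sequence of times — and the by-name certificate
  `smallConstantLiouville_of_floor : Theses.ExtremalTypeIConstant.SmallConstantLiouville`
  (stmt-NavierStokesRegularity-8218, closed; re-proved from the floor);
* §2 THE DOOR: the Type-I-rate stratum of the cut is EXACTLY the ledger door stmt-NavierStokesRegularity-4050,
  `tfl_iff_typeIAncientLiouville : TFL ↔ Theses.SymmetryModuliCount.TypeIAncientLiouville` (⟹ time shift;
  ⟸ the boost lemma `isTypeIAncientMild_boost` = `stub_oseen_const_boost` + `contDiffOn_of_bounded_oseenMild` +
  `IsWeaklyDivFree.isDivFree_of_contDiff`), and its EMPTY sub-stratum `C < 1` (`const_of_typeIRate_lt_one`, the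
  tree's similarity-enstrophy threshold `SimilarityEnstrophy.typeI_ancient_eq_zero_of_rate_lt_one` transported
  to print's class and to streams): the door's open core is the rate window `C ≥ 1`.
Part 2 (`…Strata`) = §3 the cut; Part 3 (`…Core`) = §3b the residual enemy's profile + §3c the door's open
core BY NAME (stmt-4050 ⟺ eventual Type-I fading at a constant `≥ 1` forces the stream); Part 4 = §4 exactness
at the crux + root reach. Helper for stmt-NavierStokesRegularity-10661; nothing here proves NS regularity.
-/

noncomputable section

set_option linter.dupNamespace false
set_option maxHeartbeats 800000

open MeasureTheory Set Function Filter
open Literature.Analysis.FluidPDE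

namespace Summit.NavierStokesRegularity.NavierStokesRegularity.Theorems.TypeILiouvilleSelfSimilarFloor

open Summit.NavierStokesRegularity.NavierStokesRegularity.Theorems.TypeILiouvilleAxisTestDoor (isTypeIAncientMild_boost)

/-! ## §1 THE FLOOR (PROVED): forward smoothing bound, and no fading faster than self-similar -/

section Floor

/-- **Forward bound in the print's class** (KNSS 2009 Prop. 4.1 + uniqueness of bounded mild solutions):
there are universal `ε > 0`, `C ≥ 0` such that for every continuous bounded Oseen-mild field `v` on `t < 0`,
a slice bound `‖v(s,·)‖ ≤ M` propagates forward as `‖v(t₀,·)‖ ≤ C·M` for all `t₀ ∈ (s, 0)` with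
`M²(t₀ − s) < ε`. (The KNSS smooth local solution from the datum `v(s)` lives on `(s, s + ε/M²)`, is bounded
by `C·M`, and coincides with `v` there by `oseenMild_bounded_unique`; a.e. → everywhere by continuity.)
[cite: KochNadirashviliSereginSverak2009, Prop. 4.1 with (4.3)–(4.5) (arXiv:0709.3599 p. 8)] -/
theorem forward_bound :
    ∃ ε : ℝ, 0 < ε ∧ ∃ C : ℝ, 0 ≤ C ∧
      ∀ v : ℝ → EuclideanSpace ℝ (Fin 3) → EuclideanSpace ℝ (Fin 3),
        ContinuousOn (uncurry v) (Iio 0 ×ˢ univ) →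
        (∃ K : ℝ, ∀ t < 0, ∀ x, ‖v t x‖ ≤ K) →
        (∀ s t : ℝ, s < t → t < 0 → ∀ x,
          v t x = Literature.Analysis.UnboundedOperators.heatExtension (v s) (t - s) x -
            Literature.Analysis.FluidPDE.oseenDuhamel 1 s v v t x) →
        ∀ s t₀ M : ℝ, s < t₀ → t₀ < 0 → 0 < M → (∀ x, ‖v s x‖ ≤ M) → M ^ 2 * (t₀ - s) < ε →
          ∀ x, ‖v t₀ x‖ ≤ C * M := by
  obtain ⟨ε, hε, C, hC, hL⟩ :=
    Literature.Analysis.FluidPDE.knss2009_local_smoothing_holds (EuclideanSpace ℝ (Fin 3)) 0 0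
  refine ⟨ε, hε, C, hC, ?_⟩
  intro v hcont hK hmild s t₀ M hst ht₀ hM hsM hwin x
  obtain ⟨K, hK⟩ := hK
  have hvc : ∀ σ : ℝ, σ < 0 → Continuous (v σ) := fun σ hσ =>
    hcont.comp_continuous (continuous_const.prodMk continuous_id) fun z =>
      mk_mem_prod (mem_Iio.2 hσ) (mem_univ z)
  have hs0 : s < 0 := hst.trans ht₀
  -- the datum `v s`
  have ha : AEStronglyMeasurable (v s) volume := (hvc s hs0).aestronglyMeasurable
  have haM : eLpNorm (v s) ⊤ volume ≤ ENNReal.ofReal M := by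
    rw [eLpNorm_exponent_top]
    exact eLpNormEssSup_le_of_ae_bound (Eventually.of_forall hsM)
  obtain ⟨w, hws, hweq, hwM, -⟩ := hL one_pos s hM ha haM
  -- the window
  have hwin' : t₀ < s + ε * 1 / M ^ 2 := by
    have h1 : t₀ - s < ε / M ^ 2 := by
      rw [lt_div_iff₀ (by positivity)]
      linarith [mul_comm (M ^ 2) (t₀ - s)]
    rw [mul_one]
    linarith
  set T : ℝ := min (s + ε * 1 / M ^ 2) 0 with hT_def
  have ht₀T : t₀ < T := lt_min hwin' ht₀
  have hT0 : T ≤ 0 := min_le_right _ _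
  have hTw : T ≤ s + ε * 1 / M ^ 2 := min_le_left _ _
  have hsub₀ : Ioo s T ×ˢ (univ : Set (EuclideanSpace ℝ (Fin 3))) ⊆ Iio 0 ×ˢ univ :=
    prod_mono (fun τ hτ => mem_Iio.2 (hτ.2.trans_le hT0)) subset_rfl
  have hsub₁ : Ioo s T ×ˢ (univ : Set (EuclideanSpace ℝ (Fin 3))) ⊆ Ioo s (s + ε * 1 / M ^ 2) ×ˢ univ :=
    prod_mono (Ioo_subset_Ioo_right hTw) subset_rfl
  have hum : AEStronglyMeasurable (uncurry v)
      ((volume : Measure (ℝ × EuclideanSpace ℝ (Fin 3))).restrict (Ioo s T ×ˢ univ)) :=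
    (hcont.mono hsub₀).aestronglyMeasurable (measurableSet_Ioo.prod MeasurableSet.univ)
  have hwm : AEStronglyMeasurable (uncurry w)
      ((volume : Measure (ℝ × EuclideanSpace ℝ (Fin 3))).restrict (Ioo s T ×ˢ univ)) :=
    (hws.continuousOn.mono hsub₁).aestronglyMeasurable (measurableSet_Ioo.prod MeasurableSet.univ)
  have hM' : 0 ≤ max K (C * M) := le_max_of_le_right (mul_nonneg hC hM.le)
  have huM : ∀ τ ∈ Ioo s T, ∀ y, ‖v τ y‖ ≤ max K (C * M) := fun τ hτ y =>
    (hK τ (hτ.2.trans_le hT0) y).trans (le_max_left _ _)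
  have hwM' : ∀ τ ∈ Ioo s T, ∀ y, ‖w τ y‖ ≤ max K (C * M) := fun τ hτ y =>
    (hwM τ ⟨hτ.1, hτ.2.trans_le hTw⟩ y).trans (le_max_right _ _)
  have hu : ∀ t ∈ Ioo s T, v t =ᵐ[volume] fun x =>
      Literature.Analysis.UnboundedOperators.heatExtension (v s) (t - s) x - oseenDuhamel 1 s v v t x :=
    fun t ht => Eventually.of_forall fun x => hmild s t ht.1 (ht.2.trans_le hT0) x
  have hv : ∀ t ∈ Ioo s T, w t =ᵐ[volume] fun x =>
      Literature.Analysis.UnboundedOperators.heatExtension (v s) (t - s) x - oseenDuhamel 1 s w w t x :=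
    fun t ht => Eventually.of_forall fun x => by
      rw [hweq t ⟨ht.1, ht.2.trans_le hTw⟩ x, one_mul]
  have huniq := oseenMild_bounded_unique one_pos hM' hum hwm huM hwM' hu hv
  have hae : v t₀ =ᵐ[volume] w t₀ := huniq t₀ ⟨hst, ht₀T⟩
  have hwc : Continuous (w t₀) :=
    hws.continuousOn.comp_continuous (continuous_const.prodMk continuous_id) fun z =>
      mk_mem_prod ⟨hst, hwin'⟩ (mem_univ z)
  have heq : v t₀ = w t₀ := (Continuous.ae_eq_iff_eq volume (hvc t₀ ht₀) hwc).1 hae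
  rw [show v t₀ x = w t₀ x from congrFun heq x]
  exact hwM t₀ ⟨hst, hwin'⟩ x

/-- **Forward bound relative to a stream** `c`: the same, for `‖v(t,x) − c‖`, for P-fields (weakly div-free
slices are used by the Galilean boost `w(t,y) = v(t, y + t c) − c`, `stub_oseen_const_boost`, which is again
in the print's class). [cite: KochNadirashviliSereginSverak2009, Prop. 4.1 and §4 (i) (arXiv:0709.3599 p. 8)] -/
theorem forward_bound_stream :
    ∃ ε : ℝ, 0 < ε ∧ ∃ C : ℝ, 0 ≤ C ∧
      ∀ v : ℝ → EuclideanSpace ℝ (Fin 3) → EuclideanSpace ℝ (Fin 3),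
        ContinuousOn (uncurry v) (Iio 0 ×ˢ univ) →
        (∃ K : ℝ, ∀ t < 0, ∀ x, ‖v t x‖ ≤ K) →
        (∀ t < 0, Literature.Analysis.FluidPDE.IsWeaklyDivFree (v t)) →
        (∀ s t : ℝ, s < t → t < 0 → ∀ x,
          v t x = Literature.Analysis.UnboundedOperators.heatExtension (v s) (t - s) x -
            Literature.Analysis.FluidPDE.oseenDuhamel 1 s v v t x) →
        ∀ (c : EuclideanSpace ℝ (Fin 3)) (s t₀ M : ℝ), s < t₀ → t₀ < 0 → 0 < M →
          (∀ x, ‖v s x - c‖ ≤ M) → M ^ 2 * (t₀ - s) < ε → ∀ x, ‖v t₀ x - c‖ ≤ C * M := by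
  obtain ⟨ε, hε, C, hC, hF⟩ := forward_bound
  refine ⟨ε, hε, C, hC, ?_⟩
  intro v hcont hK hdiv hmild c s t₀ M hst ht₀ hM hsM hwin x
  obtain ⟨hc', hK', -, hm'⟩ :=
    stub_oseen_const_boost v c hcont hK hdiv hmild
  have h := hF (fun t y => v t (y + t • c) - c) hc' hK' hm' s t₀ M hst ht₀ hM
    (fun y => hsM (y + s • c)) hwin (x - t₀ • c)
  simpa using h

/-- **THE SELF-SIMILAR FLOOR / stratum 0 is empty (PROVED).** There is a universal `ε₀ > 0` such that a
P-field `v` which, along SOME sequence of times `s → −∞`, is within `ε₀/√(−s)` of a constant stream `c`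
uniformly in space, is identically `c`. Equivalently: a non-constant bounded ancient mild solution satisfies
`lim inf_{s→−∞} √(−s) · sup_x ‖v(s,x) − c‖ ≥ ε₀` for EVERY stream `c` — it cannot fade faster than a
self-similar solution, not even intermittently. (Small-constant Type-I Liouville in the print's class,
sequential and relative to streams; compare the tree's classical-data rung
`ChaeWolf.exists_eps_typeI_small_eq_zero`.) [cite: KochNadirashviliSereginSverak2009, Prop. 4.1 (arXiv:0709.3599 p. 8); ChaeWolf2017RemovingDSS, §3 Step 1] -/
theorem const_of_backward_small_rate :
    ∃ ε₀ : ℝ, 0 < ε₀ ∧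
      ∀ v : ℝ → EuclideanSpace ℝ (Fin 3) → EuclideanSpace ℝ (Fin 3),
        ContinuousOn (uncurry v) (Iio 0 ×ˢ univ) →
        (∃ K : ℝ, ∀ t < 0, ∀ x, ‖v t x‖ ≤ K) →
        (∀ t < 0, Literature.Analysis.FluidPDE.IsWeaklyDivFree (v t)) →
        (∀ s t : ℝ, s < t → t < 0 → ∀ x,
          v t x = Literature.Analysis.UnboundedOperators.heatExtension (v s) (t - s) x -
            Literature.Analysis.FluidPDE.oseenDuhamel 1 s v v t x) →
        ∀ c : EuclideanSpace ℝ (Fin 3),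
          (∀ T : ℝ, T < 0 → ∃ s : ℝ, s < T ∧ ∀ x, Real.sqrt (-s) * ‖v s x - c‖ ≤ ε₀) →
          ∀ t < 0, ∀ x, v t x = c := by
  obtain ⟨ε, hε, C, hC, hF⟩ := forward_bound_stream
  refine ⟨Real.sqrt ε / 2, by positivity, ?_⟩
  intro v hcont hK hdiv hmild c hsmall t₀ ht₀ x
  have key : ∀ η : ℝ, 0 < η → ‖v t₀ x - c‖ ≤ η := by
    intro η hη
    obtain ⟨s, hsT, hs⟩ :=
      hsmall (min t₀ (-((C * Real.sqrt ε / η) ^ 2) - 1)) (lt_of_le_of_lt (min_le_left _ _) ht₀)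
    have hst : s < t₀ := hsT.trans_le (min_le_left _ _)
    have hs1 : s < -((C * Real.sqrt ε / η) ^ 2) - 1 := hsT.trans_le (min_le_right _ _)
    have hs0 : 0 < -s := by linarith
    have hrs : 0 < Real.sqrt (-s) := Real.sqrt_pos.2 hs0
    have hMpos : 0 < Real.sqrt ε / Real.sqrt (-s) := by positivity
    have hsM : ∀ y, ‖v s y - c‖ ≤ Real.sqrt ε / Real.sqrt (-s) := by
      intro y
      rw [le_div_iff₀ hrs, mul_comm]
      exact (hs y).trans (by linarith [Real.sqrt_nonneg ε])
    have hwin : (Real.sqrt ε / Real.sqrt (-s)) ^ 2 * (t₀ - s) < ε := by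
      rw [div_pow, Real.sq_sqrt hε.le, Real.sq_sqrt hs0.le, div_mul_eq_mul_div, div_lt_iff₀ hs0]
      have := mul_neg_of_pos_of_neg hε ht₀
      linarith
    have hb := hF v hcont hK hdiv hmild c s t₀ _ hst ht₀ hMpos hsM hwin x
    refine hb.trans ?_
    rw [mul_div_assoc', div_le_iff₀ hrs]
    have h1 : (C * Real.sqrt ε / η) ^ 2 < -s := by linarith
    have h2 : C * Real.sqrt ε / η < Real.sqrt (-s) := (Real.lt_sqrt (by positivity)).2 h1
    have h3 : C * Real.sqrt ε < Real.sqrt (-s) * η := (div_lt_iff₀ hη).1 h2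
    linarith [mul_comm (Real.sqrt (-s)) η]
  have h0 : ‖v t₀ x - c‖ ≤ 0 := by
    by_contra hne
    push Not at hne
    have := key (‖v t₀ x - c‖ / 2) (by linarith)
    linarith
  exact sub_eq_zero.1 (norm_le_zero_iff.1 h0)

/-- **The floor in ledger terms: `SmallConstantLiouville` (stmt-NavierStokesRegularity-8218, route
ExtremalTypeIConstant) BY NAME** — re-derived from `const_of_backward_small_rate` (a KNSS-gauge Type-I field
with constant `C < ε₀`, shifted back in time by `δ > 0`, is a P-field within `C/√(−s)` of the stream `0`;
`δ → 0`). The floor is strictly more: smallness is needed only along a sequence of times, relative to any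
stream, for merely bounded-continuous mild fields. -/
theorem smallConstantLiouville_of_floor : Theses.ExtremalTypeIConstant.SmallConstantLiouville := by
  obtain ⟨ε₀, hε₀, hF⟩ := const_of_backward_small_rate
  refine ⟨ε₀, hε₀, fun C u hu hC t ht x => ?_⟩
  have hTI : IsTypeIAncientMild C u := isTypeIAncientMild_iff.2 hu
  set δ : ℝ := -t / 2 with hδ_def
  have hδ : 0 < δ := by rw [hδ_def]; linarith
  have hTδ : IsTypeIAncientMild C (fun s => u (s - δ)) := hTI.comp_sub_right hδ.le
  have hwK : ∃ K : ℝ, ∀ s < 0, ∀ y, ‖(fun s => u (s - δ)) s y‖ ≤ K := by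
    refine ⟨C / Real.sqrt δ, fun s hs y => (hTI.norm_le (by linarith) y).trans ?_⟩
    exact div_le_div_of_nonneg_left hTI.nonneg (Real.sqrt_pos.2 hδ)
      (Real.sqrt_le_sqrt (by linarith))
  have hsmall : ∀ T : ℝ, T < 0 → ∃ s : ℝ, s < T ∧ ∀ y,
      Real.sqrt (-s) * ‖(fun s => u (s - δ)) s y - 0‖ ≤ ε₀ := by
    intro T hT
    refine ⟨T - 1, by linarith, fun y => ?_⟩
    have hpos : 0 < Real.sqrt (-(T - 1 - δ)) := Real.sqrt_pos.2 (by linarith)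
    have h1 : ‖u (T - 1 - δ) y‖ ≤ C / Real.sqrt (-(T - 1 - δ)) := hTI.norm_le (by linarith) y
    have h2 : Real.sqrt (-(T - 1)) ≤ Real.sqrt (-(T - 1 - δ)) := Real.sqrt_le_sqrt (by linarith)
    rw [sub_zero]
    calc Real.sqrt (-(T - 1)) * ‖u (T - 1 - δ) y‖
        ≤ Real.sqrt (-(T - 1 - δ)) * (C / Real.sqrt (-(T - 1 - δ))) :=
          mul_le_mul h2 h1 (norm_nonneg _) (Real.sqrt_nonneg _)
      _ = C := by rw [mul_div_assoc', mul_div_cancel_left₀ _ hpos.ne']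
      _ ≤ ε₀ := hC.le
  have hz := hF (fun s => u (s - δ)) hTδ.continuousOn_uncurry hwK
    (fun s hs => hTδ.isWeaklyDivFree hs) (fun s' t' hst' ht' y => hTδ.mild_eq_heatExtension hst' ht' y)
    0 hsmall (t + δ) (by rw [hδ_def]; linarith) x
  simpa using hz

end Floor

/-! ## §2 THE DOOR: the special cell IS the ledger door: TFL ⟺ TypeIAncientLiouville (stmt-NavierStokesRegularity-4050) -/

section Door

/-- **TFL ⟹ TypeIAncientLiouville (stmt-4050, BY NAME).** A KNSS-gauge Type-I ancient mild field, shifted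
back in time by `δ > 0`, is a print-class field converging to the stream `0` at the Type-I rate; TFL makes it
constant, and a constant with Type-I decay is `0` (`IsTypeIAncientMild.eq_zero_of_slice_const`). -/
theorem typeIAncientLiouville_of_tfl
    (hT : (∀ v : ℝ → EuclideanSpace ℝ (Fin 3) → EuclideanSpace ℝ (Fin 3),
      ContinuousOn (uncurry v) (Iio 0 ×ˢ univ) →
      (∃ K : ℝ, ∀ t < 0, ∀ x, ‖v t x‖ ≤ K) →
      (∀ t < 0, Literature.Analysis.FluidPDE.IsWeaklyDivFree (v t)) →
      (∀ s t : ℝ, s < t → t < 0 → ∀ x,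
        v t x = Literature.Analysis.UnboundedOperators.heatExtension (v s) (t - s) x -
          Literature.Analysis.FluidPDE.oseenDuhamel 1 s v v t x) →
      (∃ (c : EuclideanSpace ℝ (Fin 3)) (C : ℝ), ∀ t < 0, ∀ x, Real.sqrt (-t) * ‖v t x - c‖ ≤ C) →
      ∃ b : EuclideanSpace ℝ (Fin 3), ∀ t < 0, ∀ x, v t x = b)) :
    Theses.SymmetryModuliCount.TypeIAncientLiouville := by
  intro C u hu t ht x
  have hTI : IsTypeIAncientMild C u := isTypeIAncientMild_iff.2 hu
  set δ : ℝ := -t / 2 with hδ_def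
  have hδ : 0 < δ := by rw [hδ_def]; linarith
  have hTδ : IsTypeIAncientMild C (fun s => u (s - δ)) := hTI.comp_sub_right hδ.le
  have hwK : ∃ K : ℝ, ∀ s < 0, ∀ y, ‖(fun s => u (s - δ)) s y‖ ≤ K := by
    refine ⟨C / Real.sqrt δ, fun s hs y => (hTI.norm_le (by linarith) y).trans ?_⟩
    exact div_le_div_of_nonneg_left hTI.nonneg (Real.sqrt_pos.2 hδ)
      (Real.sqrt_le_sqrt (by linarith))
  have hwI : ∃ (c : EuclideanSpace ℝ (Fin 3)) (C' : ℝ), ∀ s < 0, ∀ y,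
      Real.sqrt (-s) * ‖(fun s => u (s - δ)) s y - c‖ ≤ C' := by
    refine ⟨0, C, fun s hs y => ?_⟩
    have hpos : 0 < Real.sqrt (-(s - δ)) := Real.sqrt_pos.2 (by linarith)
    have h1 : ‖u (s - δ) y‖ ≤ C / Real.sqrt (-(s - δ)) := hTI.norm_le (by linarith) y
    have h2 : Real.sqrt (-s) ≤ Real.sqrt (-(s - δ)) := Real.sqrt_le_sqrt (by linarith)
    rw [sub_zero]
    calc Real.sqrt (-s) * ‖u (s - δ) y‖
        ≤ Real.sqrt (-(s - δ)) * (C / Real.sqrt (-(s - δ))) :=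
          mul_le_mul h2 h1 (norm_nonneg _) (Real.sqrt_nonneg _)
      _ = C := by rw [mul_div_assoc', mul_div_cancel_left₀ _ hpos.ne']
  obtain ⟨b, hb⟩ := hT (fun s => u (s - δ)) hTδ.continuousOn_uncurry hwK
    (fun s hs => hTδ.isWeaklyDivFree hs) (fun s' t' hst' ht' y => hTδ.mild_eq_heatExtension hst' ht' y) hwI
  have hzero := hTδ.eq_zero_of_slice_const (b := fun _ => b) hb (t := t + δ) (by rw [hδ_def]; linarith) x
  simpa using hzero

-- `isTypeIAncientMild_boost` (boost to the KNSS gauge) is the tree's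
-- `Theorems.TypeILiouvilleAxisTestDoor.isTypeIAncientMild_boost` (p785965), reused below by `open`.

/-- **TypeIAncientLiouville (stmt-4050) ⟹ TFL.** Boost the stream away: the boosted field is a KNSS-gauge
Type-I ancient mild field (`isTypeIAncientMild_boost`), so stmt-4050 kills it. [cite: KochNadirashviliSereginSverak2009, Prop. 4.1 and §4 (i) (arXiv:0709.3599 p. 8)] -/
theorem tfl_of_typeIAncientLiouville (h4050 : Theses.SymmetryModuliCount.TypeIAncientLiouville) :
    (∀ v : ℝ → EuclideanSpace ℝ (Fin 3) → EuclideanSpace ℝ (Fin 3),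
      ContinuousOn (uncurry v) (Iio 0 ×ˢ univ) →
      (∃ K : ℝ, ∀ t < 0, ∀ x, ‖v t x‖ ≤ K) →
      (∀ t < 0, Literature.Analysis.FluidPDE.IsWeaklyDivFree (v t)) →
      (∀ s t : ℝ, s < t → t < 0 → ∀ x,
        v t x = Literature.Analysis.UnboundedOperators.heatExtension (v s) (t - s) x -
          Literature.Analysis.FluidPDE.oseenDuhamel 1 s v v t x) →
      (∃ (c : EuclideanSpace ℝ (Fin 3)) (C : ℝ), ∀ t < 0, ∀ x, Real.sqrt (-t) * ‖v t x - c‖ ≤ C) →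
      ∃ b : EuclideanSpace ℝ (Fin 3), ∀ t < 0, ∀ x, v t x = b) := by
  intro v hcont hK hdiv hmild hI
  obtain ⟨c, C, hC⟩ := hI
  have hz : ∀ t < 0, ∀ y, v t (y + t • c) - c = 0 :=
    h4050 C _ (isTypeIAncientMild_iff.1 (isTypeIAncientMild_boost hcont hK hdiv hmild hC))
  refine ⟨c, fun t ht x => ?_⟩
  have h := hz t ht (x - t • c)
  simp only [sub_add_cancel] at h
  exact sub_eq_zero.1 h

/-- **EXACT IDENTIFICATION: TFL ⟺ TypeIAncientLiouville (stmt-NavierStokesRegularity-4050).** -/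
theorem tfl_iff_typeIAncientLiouville :
    (∀ v : ℝ → EuclideanSpace ℝ (Fin 3) → EuclideanSpace ℝ (Fin 3),
      ContinuousOn (uncurry v) (Iio 0 ×ˢ univ) →
      (∃ K : ℝ, ∀ t < 0, ∀ x, ‖v t x‖ ≤ K) →
      (∀ t < 0, Literature.Analysis.FluidPDE.IsWeaklyDivFree (v t)) →
      (∀ s t : ℝ, s < t → t < 0 → ∀ x,
        v t x = Literature.Analysis.UnboundedOperators.heatExtension (v s) (t - s) x -
          Literature.Analysis.FluidPDE.oseenDuhamel 1 s v v t x) →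
      (∃ (c : EuclideanSpace ℝ (Fin 3)) (C : ℝ), ∀ t < 0, ∀ x, Real.sqrt (-t) * ‖v t x - c‖ ≤ C) →
      ∃ b : EuclideanSpace ℝ (Fin 3), ∀ t < 0, ∀ x, v t x = b) ↔
    Theses.SymmetryModuliCount.TypeIAncientLiouville :=
  ⟨typeIAncientLiouville_of_tfl, tfl_of_typeIAncientLiouville⟩

/-- **Below the rate `1` the Type-I stratum is EMPTY too** (the tree's similarity-enstrophy threshold T31⁗,
`SimilarityEnstrophy.typeI_ancient_eq_zero_of_rate_lt_one`, transported to print's class and to streams by the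
boost `isTypeIAncientMild_boost`): a P-field with `√(−t)‖v(t,x) − c‖ ≤ C` for all `t < 0`, `x`, where `C < 1`,
is identically `c`. So the open core of the door TFL ≡ stmt-4050 is the rate window `C ≥ 1` — exactly the
open core of stmt-4050 recorded in `SymmetryModuliCountTypeIAncientLiouvilleSmallRate`. -/
theorem const_of_typeIRate_lt_one :
    ∀ v : ℝ → EuclideanSpace ℝ (Fin 3) → EuclideanSpace ℝ (Fin 3),
      ContinuousOn (uncurry v) (Iio 0 ×ˢ univ) →
      (∃ K : ℝ, ∀ t < 0, ∀ x, ‖v t x‖ ≤ K) →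
      (∀ t < 0, Literature.Analysis.FluidPDE.IsWeaklyDivFree (v t)) →
      (∀ s t : ℝ, s < t → t < 0 → ∀ x,
        v t x = Literature.Analysis.UnboundedOperators.heatExtension (v s) (t - s) x -
          Literature.Analysis.FluidPDE.oseenDuhamel 1 s v v t x) →
      ∀ (c : EuclideanSpace ℝ (Fin 3)) (C : ℝ), C < 1 →
        (∀ t < 0, ∀ x, Real.sqrt (-t) * ‖v t x - c‖ ≤ C) → ∀ t < 0, ∀ x, v t x = c := by
  intro v hcont hK hdiv hmild c C hC1 hC t ht x
  have hz := SimilarityEnstrophy.typeI_ancient_eq_zero_of_rate_lt_one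
    (isTypeIAncientMild_boost hcont hK hdiv hmild hC) hC1 t ht (x - t • c)
  simp only [sub_add_cancel] at hz
  exact sub_eq_zero.1 hz

end Door

end Summit.NavierStokesRegularity.NavierStokesRegularity.Theorems.TypeILiouvilleSelfSimilarFloor

end
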